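import Summits.QuantumFields.BalabanUV.Beta.GAN24.InsertionChainLawMixed

/-!
# `BalabanUV.Beta.GAN24.InsertionChainLawWords` — binder row G-an2-4 ∕ (CONV-C), routes R6 × R7 in NE2's operator currency, PART 122: CHAINS OF ANY LENGTH IN ANY MIX OF
# PERTURBATIONS.  For a family of perturbation pairs `(P_i, P_i′)_{i ∈ σ}` (several background directions ∕ vertex types) and a WORD `w = [i₁, …, i_n]`, the chain
# `T_w = G P_{i₁} G P_{i₂} ⋯ G P_{i_n} G` (`= List.foldr (fun i M ↦ G·P_i·M) G w`; the mixed `n`-th derivative `∂_{t_{i₁}}⋯∂_{t_{i_n}}` of `(D + Σ_i t_iP_i)⁻¹` is the sum of `T_w`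
# over the orderings) obeys the injected law `‖T′_wJ − JT_w‖ ≤ (n+1)κ^n e₁ + nκ^{n−1}c` and the sandwiched law `+ κ^n(e₀ + 2f)` under UNIFORM letters `‖P_iG‖, ‖GP_i‖, ‖G′P_i′‖ ≤ κ`,
# `‖G′(P_i′J − JP_i)G‖ ≤ c` — PART 115 (one letter, `w = [i,…,i]`) and PART 119 (`w = [i₁, i₂]`) are the special cases; along a tower and on King's tower with a FAMILY of Lipschitz
# connections: UNCONDITIONAL convergence at rate `L^{−k}` of every mixed background-derivative of Bałaban's vector propagator (unit b2b-balaban-gan24-p3, gen 51; v1)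

NOT IN PRINT; OUR PROOF ([folklore] `List` induction on the Leibniz recursion of PART 115; PART 119's generic sandwich step `opNorm_sandwich_of_injected`; NE2's `FreeTowerLaws` ∕
`PerturbationLaws` ∕ `freeTowerLaws_king` ∕ `perturbationLaws_firstOrder` BY NAME).
HONEST FRAMING (cell contract, verbatim): «discharging `BetaPertH` makes Bałaban's UV stability UNCONDITIONAL — a real constructive-QFT result; it is NOT the continuum limit and NOT
the Clay problem.»  HONEST DEPENDENCY (verbatim): «continuum YM on T⁴ ⇐ BetaPertH ∧ nine spine estimates (0/9 proved); BetaPertH ⇐ (D1) ∧ (D4) ∧ CAP+tail; G-an2-4 gates asym, D1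
and NE2/3/4.»

WHAT THIS FILE PROVES (0 sorry, 0 `def`, nothing cited; `σ` any index type; chains written as `List.foldr`, no definition introduced):
* §1 `chain_eq_mul_tailProd` (`T_w = G·R_w`, `R_w = foldr (P_i·G·—) 1 w`), `chain_eq_headProd_mul` (`T_w = L_w·G`, `L_w = foldr (G·P_i·—) 1 w`), `opNorm_tailProd_le` ∕ `opNorm_headProd_le`
  (`≤ κ^{|w|}`), `word_cons_sub_eq` (EXACT Leibniz recursion), **`opNorm_word_injected_le`** (`‖T′_wJ − JT_w‖ ≤ (|w|+1)κ^{|w|}e₁ + |w|κ^{|w|−1}c`).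
* §2 **`opNorm_word_sandwich_le`** (`+ κ^{|w|}(e₀ + 2f)`).
* §3 along a tower: **`oneStepAveragedLaw_word`** ∕ **`towerLimitRate_word`** (`FreeTowerLaws` + `∀ i, PerturbationLaws D (P i) J κ c`).
* §4 King's tower: **`towerLimitRate_word_king`**; **`towerLimitRate_wordFirstOrder`** — a FAMILY `V_i` of Lipschitz connections with common `(α, β)`: for EVERY word `w`, the King-averaged
  unit-lattice images of `𝒢(V_{i₁}·∇)𝒢(V_{i₂}·∇)⋯𝒢` CONVERGE at rate `L^{−k}`, UNCONDITIONALLY.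
WHAT IT DOES NOT DO: non-uniform letters per direction (take `κ = max κ_i`, `c = max c_i`); Bałaban's vertices; decay.  SUPPLIER work (junction R6 × R7 × NE2); no consumer of record;
NEVER «G-an2-4 closed»; NOT (CONV-C), NOT D1, NOT `BetaPertH`, NOT continuum, NOT Clay.  Records: `HOME/b2b-balaban-gan24-p3/gen51/README.md`.
-/

noncomputable section

open scoped BigOperators ComplexConjugate Matrix Matrix.Norms.L2Operator
open Filter Topology

namespace Summit.QuantumFields.BalabanUV.Beta.GAN24.InsertionChainLawWords

open Literature.MathematicalPhysics.QuantumFieldTheory.Balaban1983to89.B5Prop11Plancherel (Cst Cst_nonneg)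
open Summit.QuantumFields.BalabanUV.T4Continuum
open Summit.QuantumFields.BalabanUV.T4Continuum.BackgroundResolventLaw (l2_opNorm_one_le)
open Summit.QuantumFields.BalabanUV.T4Continuum.CovariantAveragingTower (OneStepAveragedLaw TowerLimitRate towerLimitRate_of_oneStepAveragedLaw)
open Summit.QuantumFields.BalabanUV.T4Continuum.BalabanAveragedTowerUnit (idx Qlev calGlev opNorm_Qlev_sq_le)
open Summit.QuantumFields.BalabanUV.T4Continuum.BackgroundResolventTower (FreeTowerLaws PerturbationLaws opNorm_normalised_le)
open Summit.QuantumFields.BalabanUV.T4Continuum.KingPairingPlantedLaw (JpcT calDalev calDalev_inv CJ)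
open Summit.QuantumFields.BalabanUV.T4Continuum.NE2PerturbedLayer (freeTowerLaws_king)
open Summit.QuantumFields.BalabanUV.T4Continuum.FirstOrderBackgroundModel (LipschitzBackground Pmodel C2model perturbationLaws_firstOrder)
open Summit.QuantumFields.BalabanUV.Beta.GAN24.InsertionChainLaw (natCast_mul_mul_pow_pred)
open Summit.QuantumFields.BalabanUV.Beta.GAN24.InsertionChainLawMixed (opNorm_sandwich_of_injected)

/-! ## §1 Words: shift identities, product bounds, the Leibniz recursion, the injected law -/

section TwoLevel

variable {σ : Type*} {m n : Type*} [Fintype m] [DecidableEq m] [Fintype n] [DecidableEq n]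
variable {G : Matrix n n ℂ} {P : σ → Matrix n n ℂ} {G' : Matrix m m ℂ} {P' : σ → Matrix m m ℂ} {J : Matrix m n ℂ}

/-- right shift: `T_w = G·R_w` with `R_w = foldr (fun i M ↦ P_i·G·M) 1 w`. [folklore] -/
theorem chain_eq_mul_tailProd (G : Matrix n n ℂ) (P : σ → Matrix n n ℂ) (w : List σ) :
    List.foldr (fun i M => G * P i * M) G w = G * List.foldr (fun i M => P i * G * M) 1 w := by
  induction w with
  | nil => simp only [List.foldr_nil, Matrix.mul_one]
  | cons i w ih =>
    simp only [List.foldr_cons]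
    rw [ih]
    simp only [Matrix.mul_assoc]

/-- left shift: `T_w = L_w·G` with `L_w = foldr (fun i M ↦ G·P_i·M) 1 w`. [folklore] -/
theorem chain_eq_headProd_mul (G : Matrix n n ℂ) (P : σ → Matrix n n ℂ) (w : List σ) :
    List.foldr (fun i M => G * P i * M) G w = List.foldr (fun i M => G * P i * M) 1 w * G := by
  induction w with
  | nil => simp only [List.foldr_nil, Matrix.one_mul]
  | cons i w ih =>
    simp only [List.foldr_cons]
    rw [ih]
    simp only [Matrix.mul_assoc]

/-- `‖R_w‖ ≤ κ^{|w|}` from `‖P_iG‖ ≤ κ`. [folklore] -/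
theorem opNorm_tailProd_le {κ : ℝ} (hPG : ∀ i, ‖P i * G‖ ≤ κ) (hκ : 0 ≤ κ) (w : List σ) :
    ‖List.foldr (fun i M => P i * G * M) 1 w‖ ≤ κ ^ w.length := by
  induction w with
  | nil => rw [List.foldr_nil, List.length_nil, pow_zero]; exact l2_opNorm_one_le
  | cons i w ih =>
    rw [List.foldr_cons, List.length_cons, pow_succ']
    exact (Matrix.l2_opNorm_mul _ _).trans (mul_le_mul (hPG i) ih (norm_nonneg _) hκ)

/-- `‖L_w‖ ≤ κ^{|w|}` from `‖GP_i‖ ≤ κ`. [folklore] -/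
theorem opNorm_headProd_le {κ : ℝ} (hGP : ∀ i, ‖G * P i‖ ≤ κ) (hκ : 0 ≤ κ) (w : List σ) :
    ‖List.foldr (fun i M => G * P i * M) 1 w‖ ≤ κ ^ w.length := by
  induction w with
  | nil => rw [List.foldr_nil, List.length_nil, pow_zero]; exact l2_opNorm_one_le
  | cons i w ih =>
    rw [List.foldr_cons, List.length_cons, pow_succ']
    exact (Matrix.l2_opNorm_mul _ _).trans (mul_le_mul (hGP i) ih (norm_nonneg _) hκ)

omit [DecidableEq m] [DecidableEq n] in
/-- **THE LEIBNIZ RECURSION FOR WORDS** (EXACT): `T′_{i::w}J − JT_{i::w} = G′P_i′·(T′_wJ − JT_w) + (G′(P_i′J − JP_i) + (G′J − JG)P_i)·T_w`. [our proof] -/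
theorem word_cons_sub_eq (i : σ) (w : List σ) :
    List.foldr (fun i M => G' * P' i * M) G' (i :: w) * J - J * List.foldr (fun i M => G * P i * M) G (i :: w)
      = G' * P' i * (List.foldr (fun i M => G' * P' i * M) G' w * J - J * List.foldr (fun i M => G * P i * M) G w)
        + (G' * (P' i * J - J * P i) + (G' * J - J * G) * P i) * List.foldr (fun i M => G * P i * M) G w := by
  simp only [List.foldr_cons, Matrix.mul_sub, Matrix.sub_mul, Matrix.add_mul, Matrix.mul_assoc]
  abel

/-- **`opNorm_word_injected_le` — THE INJECTED ONE-STEP LAW OF A CHAIN OF ANY LENGTH AND MIX** [our proof]: uniform letters `‖P_iG‖, ‖G′P_i′‖ ≤ κ`, `‖G′J − JG‖ ≤ e₁`,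
`‖G′(P_i′J − JP_i)G‖ ≤ c` ⟹ for every word `w`, `‖T′_wJ − JT_w‖ ≤ (|w|+1)κ^{|w|}e₁ + |w|κ^{|w|−1}c`. -/
theorem opNorm_word_injected_le {κ e₁ c : ℝ} (hPG : ∀ i, ‖P i * G‖ ≤ κ) (hG'P' : ∀ i, ‖G' * P' i‖ ≤ κ) (hκ : 0 ≤ κ)
    (h₁ : ‖G' * J - J * G‖ ≤ e₁) (h₂ : ∀ i, ‖G' * (P' i * J - J * P i) * G‖ ≤ c) (hc : 0 ≤ c) (w : List σ) :
    ‖List.foldr (fun i M => G' * P' i * M) G' w * J - J * List.foldr (fun i M => G * P i * M) G w‖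
      ≤ (w.length + 1) * κ ^ w.length * e₁ + w.length * κ ^ (w.length - 1) * c := by
  have he₁ : 0 ≤ e₁ := (norm_nonneg _).trans h₁
  induction w with
  | nil =>
    simp only [List.foldr_nil, List.length_nil, Nat.cast_zero, zero_add, one_mul, pow_zero, zero_mul, add_zero]
    exact h₁
  | cons i w ih =>
    rw [word_cons_sub_eq]
    set n := w.length with hn
    have hlen : (i :: w).length = n + 1 := by rw [List.length_cons]
    rw [hlen]
    -- the source term through the right shift
    have hsrc : (G' * (P' i * J - J * P i) + (G' * J - J * G) * P i) * List.foldr (fun i M => G * P i * M) G w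
        = G' * (P' i * J - J * P i) * G * List.foldr (fun i M => P i * G * M) 1 w
          + (G' * J - J * G) * (P i * G * List.foldr (fun i M => P i * G * M) 1 w) := by
      rw [chain_eq_mul_tailProd, Matrix.add_mul]
      simp only [Matrix.mul_assoc]
    rw [hsrc]
    have hR := opNorm_tailProd_le hPG hκ w
    have t1 : ‖G' * P' i * (List.foldr (fun i M => G' * P' i * M) G' w * J - J * List.foldr (fun i M => G * P i * M) G w)‖
        ≤ κ * (((n : ℝ) + 1) * κ ^ n * e₁ + (n : ℝ) * κ ^ (n - 1) * c) :=
      (Matrix.l2_opNorm_mul _ _).trans (mul_le_mul (hG'P' i) ih (norm_nonneg _) hκ)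
    have t2 : ‖G' * (P' i * J - J * P i) * G * List.foldr (fun i M => P i * G * M) 1 w‖ ≤ c * κ ^ n :=
      (Matrix.l2_opNorm_mul _ _).trans (mul_le_mul (h₂ i) hR (norm_nonneg _) hc)
    have t3 : ‖(G' * J - J * G) * (P i * G * List.foldr (fun i M => P i * G * M) 1 w)‖ ≤ e₁ * (κ * κ ^ n) := by
      refine (Matrix.l2_opNorm_mul _ _).trans (mul_le_mul h₁ ?_ (norm_nonneg _) he₁)
      exact (Matrix.l2_opNorm_mul _ _).trans (mul_le_mul (hPG i) hR (norm_nonneg _) hκ)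
    have hk := natCast_mul_mul_pow_pred κ n
    have harith : κ * (((n : ℝ) + 1) * κ ^ n * e₁ + (n : ℝ) * κ ^ (n - 1) * c) + (c * κ ^ n + e₁ * (κ * κ ^ n))
        = (((n + 1 : ℕ) : ℝ) + 1) * κ ^ (n + 1) * e₁ + ((n + 1 : ℕ) : ℝ) * κ ^ (n + 1 - 1) * c := by
      have hk' : κ * ((n : ℝ) * κ ^ (n - 1) * c) = (n : ℝ) * κ ^ n * c := by
        calc κ * ((n : ℝ) * κ ^ (n - 1) * c) = ((n : ℝ) * (κ * κ ^ (n - 1))) * c := by ring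
          _ = (n : ℝ) * κ ^ n * c := by rw [hk]
      rw [Nat.add_sub_cancel]
      push_cast
      simp only [pow_succ]
      linear_combination hk'
    calc _ ≤ ‖G' * P' i * (List.foldr (fun i M => G' * P' i * M) G' w * J - J * List.foldr (fun i M => G * P i * M) G w)‖
            + (‖G' * (P' i * J - J * P i) * G * List.foldr (fun i M => P i * G * M) 1 w‖ + ‖(G' * J - J * G) * (P i * G * List.foldr (fun i M => P i * G * M) 1 w)‖) :=
          (norm_add_le _ _).trans (add_le_add le_rfl (norm_add_le _ _))
      _ ≤ κ * (((n : ℝ) + 1) * κ ^ n * e₁ + (n : ℝ) * κ ^ (n - 1) * c) + (c * κ ^ n + e₁ * (κ * κ ^ n)) := add_le_add t1 (add_le_add t2 t3)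
      _ = (((n + 1 : ℕ) : ℝ) + 1) * κ ^ (n + 1) * e₁ + ((n + 1 : ℕ) : ℝ) * κ ^ (n + 1 - 1) * c := harith

/-! ## §2 The sandwiched law of a word -/

/-- **`opNorm_word_sandwich_le`** [our proof]: the letters of `opNorm_word_injected_le` plus `‖GP_i‖ ≤ κ`, `‖Ã‖, ‖J‖ ≤ 1`, `ÃJ = 1 + F`, `‖FG‖, ‖GFᴴ‖ ≤ f`, `‖G′(1 − JJᴴ)‖ ≤ e₀` ⟹
`‖ÃT′_wÃᴴ − T_w‖ ≤ (|w|+1)κ^{|w|}e₁ + |w|κ^{|w|−1}c + κ^{|w|}(e₀ + 2f)` (PART 119's generic sandwich step; complement through the left shift, pairings through both shifts). -/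
theorem opNorm_word_sandwich_le {κ e₀ e₁ c f : ℝ} (hPG : ∀ i, ‖P i * G‖ ≤ κ) (hGP : ∀ i, ‖G * P i‖ ≤ κ) (hG'P' : ∀ i, ‖G' * P' i‖ ≤ κ) (hκ : 0 ≤ κ)
    {At : Matrix n m ℂ} (hAt : ‖At‖ ≤ 1) (hJ : ‖J‖ ≤ 1) {F : Matrix n n ℂ} (hAJ : At * J = 1 + F)
    (hF : ‖F * G‖ ≤ f) (hF' : ‖G * Fᴴ‖ ≤ f) (h₀ : ‖G' * (1 - J * Jᴴ)‖ ≤ e₀) (h₁ : ‖G' * J - J * G‖ ≤ e₁)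
    (h₂ : ∀ i, ‖G' * (P' i * J - J * P i) * G‖ ≤ c) (hc : 0 ≤ c) (w : List σ) :
    ‖At * List.foldr (fun i M => G' * P' i * M) G' w * Atᴴ - List.foldr (fun i M => G * P i * M) G w‖
      ≤ ((w.length + 1) * κ ^ w.length * e₁ + w.length * κ ^ (w.length - 1) * c) + κ ^ w.length * (e₀ + 2 * f) := by
  have hf : 0 ≤ f := (norm_nonneg _).trans hF
  have hκn : 0 ≤ κ ^ w.length := pow_nonneg hκ _
  have hi := opNorm_word_injected_le hPG hG'P' hκ h₁ h₂ hc w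
  have hc₀ : ‖List.foldr (fun i M => G' * P' i * M) G' w * (1 - J * Jᴴ)‖ ≤ κ ^ w.length * e₀ := by
    rw [chain_eq_headProd_mul, Matrix.mul_assoc]
    exact (Matrix.l2_opNorm_mul _ _).trans (mul_le_mul (opNorm_headProd_le hG'P' hκ w) h₀ (norm_nonneg _) hκn)
  have hp : ‖F * List.foldr (fun i M => G * P i * M) G w‖ ≤ f * κ ^ w.length := by
    rw [chain_eq_mul_tailProd, ← Matrix.mul_assoc]
    exact (Matrix.l2_opNorm_mul _ _).trans (mul_le_mul hF (opNorm_tailProd_le hPG hκ w) (norm_nonneg _) hf)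
  have hp' : ‖List.foldr (fun i M => G * P i * M) G w * Fᴴ‖ ≤ κ ^ w.length * f := by
    rw [chain_eq_headProd_mul, Matrix.mul_assoc]
    exact (Matrix.l2_opNorm_mul _ _).trans (mul_le_mul (opNorm_headProd_le hGP hκ w) hF' (norm_nonneg _) hκn)
  calc _ ≤ ((w.length + 1) * κ ^ w.length * e₁ + w.length * κ ^ (w.length - 1) * c) + κ ^ w.length * e₀ + f * κ ^ w.length + κ ^ w.length * f :=
        opNorm_sandwich_of_injected hAt hJ hAJ hi hc₀ hp hp'
    _ = _ := by ring

end TwoLevel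

/-! ## §3 Along a tower -/

section Tower

variable {σ : Type*} {ι : ℕ → Type*} [∀ k, Fintype (ι k)] [∀ k, DecidableEq (ι k)]
variable {D : (k : ℕ) → Matrix (ι k) (ι k) ℂ} {P : σ → (k : ℕ) → Matrix (ι k) (ι k) ℂ} {A : (k : ℕ) → Matrix (ι k) (ι (k + 1)) ℂ}
  {J : (k : ℕ) → Matrix (ι (k + 1)) (ι k) ℂ} {F : (k : ℕ) → Matrix (ι k) (ι k) ℂ} {r κ : ℝ} {e₀ e₁ c f : ℕ → ℝ}

/-- **`oneStepAveragedLaw_word`** [our proof]: `FreeTowerLaws D A J F r e₀ e₁ f`, `∀ i, PerturbationLaws D (P i) J κ c` ⟹ for every word `w` of length `n`,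
`OneStepAveragedLaw A r (k ↦ foldr (fun i M ↦ D_k⁻¹·P_{i,k}·M) D_k⁻¹ w) (k ↦ (n+1)κ^n e₁ k + nκ^{n−1}c k + κ^n(e₀ k + 2f k))`. -/
theorem oneStepAveragedLaw_word (hr : 0 < r) (hfree : FreeTowerLaws D A J F r e₀ e₁ f) (hpert : ∀ i, PerturbationLaws D (P i) J κ c) (hκ : 0 ≤ κ)
    (hc : ∀ k, 0 ≤ c k) (w : List σ) :
    OneStepAveragedLaw A r (fun k => List.foldr (fun i M => (D k)⁻¹ * P i k * M) (D k)⁻¹ w)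
      (fun k => ((w.length + 1) * κ ^ w.length * e₁ k + w.length * κ ^ (w.length - 1) * c k) + κ ^ w.length * (e₀ k + 2 * f k)) := by
  intro k
  have hs0 : 0 < Real.sqrt r := Real.sqrt_pos.mpr hr
  set At : Matrix (ι k) (ι (k + 1)) ℂ := (((Real.sqrt r : ℝ) : ℂ)) • A k with hAt_def
  have hAt : ‖At‖ ≤ 1 := opNorm_normalised_le hr (hfree.opNorm_A_sq_le k)
  have hAJ : At * J k = 1 + F k := by rw [hAt_def, Matrix.smul_mul]; exact hfree.A_mul_J k
  have key := opNorm_word_sandwich_le (G := (D k)⁻¹) (G' := (D (k + 1))⁻¹) (P := fun i => P i k) (P' := fun i => P i (k + 1)) (J := J k)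
    (fun i => (hpert i).opNorm_P_mul_inv_le k) (fun i => (hpert i).opNorm_inv_mul_P_le k) (fun i => (hpert i).opNorm_inv_mul_P_le (k + 1)) hκ hAt
    (hfree.opNorm_J_le k) hAJ (hfree.opNorm_F_mul_inv_le k) (hfree.opNorm_inv_mul_F_le k) (hfree.complement_le k) (hfree.injected_le k)
    (fun i => (hpert i).consistent_le k) (hc k) w
  have hss : star ((((Real.sqrt r : ℝ) : ℂ))) = (((Real.sqrt r : ℝ) : ℂ)) := Complex.conj_ofReal _
  have hsq : ((((Real.sqrt r : ℝ) : ℂ))) * (((Real.sqrt r : ℝ) : ℂ)) = (r : ℂ) := by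
    rw [← Complex.ofReal_mul, Real.mul_self_sqrt hr.le]
  have hrC : (r : ℂ) ≠ 0 := by exact_mod_cast hr.ne'
  have e : A k * List.foldr (fun i M => (D (k + 1))⁻¹ * P i (k + 1) * M) (D (k + 1))⁻¹ w * (A k)ᴴ
        - ((r : ℂ))⁻¹ • List.foldr (fun i M => (D k)⁻¹ * P i k * M) (D k)⁻¹ w
      = ((r : ℂ))⁻¹ • (At * List.foldr (fun i M => (D (k + 1))⁻¹ * P i (k + 1) * M) (D (k + 1))⁻¹ w * Atᴴ
          - List.foldr (fun i M => (D k)⁻¹ * P i k * M) (D k)⁻¹ w) := by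
    rw [hAt_def, Matrix.conjTranspose_smul, hss, Matrix.smul_mul, Matrix.smul_mul, Matrix.mul_smul, smul_smul, hsq,
      smul_sub, smul_smul, inv_mul_cancel₀ hrC, one_smul]
  rw [e, norm_smul, norm_inv, Complex.norm_real, Real.norm_of_nonneg hr.le]
  exact mul_le_mul_of_nonneg_left key (inv_nonneg.mpr hr.le)

/-- **`towerLimitRate_word`** [our proof]: geometric letters `e₀, e₁, f ≤ C·ρ^k`, `c ≤ C₂ρ^k`, `ρ < 1` ⟹ for every word of length `n`,
`TowerLimitRate A r (k ↦ T_{w,k}) ((n+1)κ^nC₁ + nκ^{n−1}C₂ + κ^n(C₀ + 2C_f)) ρ`. -/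
theorem towerLimitRate_word (hr : 0 < r) (hfree : FreeTowerLaws D A J F r e₀ e₁ f) (hpert : ∀ i, PerturbationLaws D (P i) J κ c) (hκ : 0 ≤ κ)
    (hc : ∀ k, 0 ≤ c k) {ρ C₀ C₁ C₂ Cf : ℝ} (hρ1 : ρ < 1) (h₀ : ∀ k, e₀ k ≤ C₀ * ρ ^ k) (h₁ : ∀ k, e₁ k ≤ C₁ * ρ ^ k) (h₂ : ∀ k, c k ≤ C₂ * ρ ^ k)
    (hf : ∀ k, f k ≤ Cf * ρ ^ k) (w : List σ) :
    TowerLimitRate A r (fun k => List.foldr (fun i M => (D k)⁻¹ * P i k * M) (D k)⁻¹ w)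
      (((w.length + 1) * κ ^ w.length * C₁ + w.length * κ ^ (w.length - 1) * C₂) + κ ^ w.length * (C₀ + 2 * Cf)) ρ := by
  have hlaw : OneStepAveragedLaw A r (fun k => List.foldr (fun i M => (D k)⁻¹ * P i k * M) (D k)⁻¹ w)
      (fun k => (((w.length + 1) * κ ^ w.length * C₁ + w.length * κ ^ (w.length - 1) * C₂) + κ ^ w.length * (C₀ + 2 * Cf)) * ρ ^ k) := by
    intro k
    refine (oneStepAveragedLaw_word hr hfree hpert hκ hc w k).trans (mul_le_mul_of_nonneg_left ?_ (inv_nonneg.mpr hr.le))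
    have hκn : 0 ≤ κ ^ w.length := pow_nonneg hκ _
    have hκn' : 0 ≤ κ ^ (w.length - 1) := pow_nonneg hκ _
    have a1 : (w.length + 1) * κ ^ w.length * e₁ k ≤ (w.length + 1) * κ ^ w.length * (C₁ * ρ ^ k) :=
      mul_le_mul_of_nonneg_left (h₁ k) (mul_nonneg (by positivity) hκn)
    have a2 : w.length * κ ^ (w.length - 1) * c k ≤ w.length * κ ^ (w.length - 1) * (C₂ * ρ ^ k) :=
      mul_le_mul_of_nonneg_left (h₂ k) (mul_nonneg (Nat.cast_nonneg _) hκn')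
    have a3 : κ ^ w.length * (e₀ k + 2 * f k) ≤ κ ^ w.length * ((C₀ + 2 * Cf) * ρ ^ k) := by
      refine mul_le_mul_of_nonneg_left ?_ hκn
      nlinarith [h₀ k, hf k]
    nlinarith [a1, a2, a3]
  exact towerLimitRate_of_oneStepAveragedLaw A hr hfree.opNorm_A_sq_le _ hρ1 hlaw

end Tower

/-! ## §4 King's tower: any family; a family of Lipschitz connections unconditionally -/

section King

variable {σ : Type*} {d : ℕ} (L : ℕ) [NeZero L] (M : Fin d → ℕ) [hM : ∀ μ, NeZero (M μ)] (a : ℝ) (ha : 0 < a)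

/-- **`towerLimitRate_word_king`** [our proof] (`L ≥ 2`): a family `P_i` with `PerturbationLaws (Δ_a^{(·)}) (P i) J κ (C₂L^{−k})` for every `i` (`κ, C₂ ≥ 0`) ⟹ for every word `w`
of length `n`, the King-averaged unit-lattice images of `𝒢P_{i₁}𝒢P_{i₂}⋯𝒢` CONVERGE at rate `L^{−k}` with constant `(n+1)κ^nCJ + nκ^{n−1}C₂ + κ^n·2dCst`. -/
theorem towerLimitRate_word_king (hL : 2 ≤ L) {P : σ → (k : ℕ) → Matrix (idx L M k) (idx L M k) ℂ} {κ C₂ : ℝ} (hκ : 0 ≤ κ) (hC₂ : 0 ≤ C₂)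
    (hpert : ∀ i, PerturbationLaws (calDalev L M a ha) (P i) (JpcT L M) κ (fun k => C₂ * ((L : ℝ)⁻¹) ^ k)) (w : List σ) :
    TowerLimitRate (Qlev L M) ((L : ℝ) ^ d) (fun k => List.foldr (fun i N => (calDalev L M a ha k)⁻¹ * P i k * N) (calDalev L M a ha k)⁻¹ w)
      (((w.length + 1) * κ ^ w.length * CJ d a + w.length * κ ^ (w.length - 1) * C₂) + κ ^ w.length * (2 * d * Cst d a)) ((L : ℝ)⁻¹) := by
  have hL1 : (1 : ℝ) < L := by exact_mod_cast (lt_of_lt_of_le one_lt_two hL : 1 < L)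
  have hr : (0 : ℝ) < (L : ℝ) ^ d := pow_pos (lt_trans zero_lt_one hL1) d
  have hLinv : 0 ≤ (L : ℝ)⁻¹ := inv_nonneg.mpr (le_of_lt (lt_trans zero_lt_one hL1))
  have h := towerLimitRate_word hr (freeTowerLaws_king L M a ha) hpert hκ (fun k => mul_nonneg hC₂ (pow_nonneg hLinv k)) (inv_lt_one_of_one_lt₀ hL1)
    (fun k => le_rfl) (fun k => le_rfl) (fun k => le_rfl) (fun k => le_of_eq (zero_mul _).symm) w
  simp only [mul_zero, add_zero] at h
  exact h

/-- **`towerLimitRate_wordFirstOrder` — EVERY MIXED BACKGROUND-DERIVATIVE OF BAŁABAN's VECTOR PROPAGATOR BY A FAMILY OF LIPSCHITZ CONNECTIONS, UNCONDITIONALLY** [our proof]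
(`L ≥ 2`, `d ≥ 1`, `LipschitzBackground (V i) α β` for every `i`): for every word `w = [i₁,…,i_n]`, the King-averaged unit-lattice images of
`𝒢^{(k)}(V_{i₁}^{(k)}·∇)𝒢^{(k)}(V_{i₂}^{(k)}·∇)⋯𝒢^{(k)}` CONVERGE as `k → ∞` at rate `L^{−k}`, constant `(n+1)κ^nCJ + nκ^{n−1}C2model + κ^n·2dCst`, `κ = d(α+β)Cst`. -/
theorem towerLimitRate_wordFirstOrder (hL : 2 ≤ L) (hd : 1 ≤ d) {V : σ → (k : ℕ) → Fin d → (idx L M k → ℂ)} {α β : ℝ}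
    (hV : ∀ i, LipschitzBackground L M (V i) α β) [Nonempty σ] (w : List σ) :
    TowerLimitRate (Qlev L M) ((L : ℝ) ^ d) (fun k => List.foldr (fun i N => calGlev L M a ha k * Pmodel L M (V i) k * N) (calGlev L M a ha k) w)
      (((w.length + 1) * (d * (α + β) * Cst d a) ^ w.length * CJ d a + w.length * (d * (α + β) * Cst d a) ^ (w.length - 1) * C2model d L a α β)
        + (d * (α + β) * Cst d a) ^ w.length * (2 * d * Cst d a)) ((L : ℝ)⁻¹) := by
  obtain ⟨i₀⟩ := ‹Nonempty σ›
  obtain ⟨hα, hβ⟩ := (hV i₀).nonneg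
  have hC := Cst_nonneg d a
  have hκ : 0 ≤ d * (α + β) * Cst d a := mul_nonneg (mul_nonneg (Nat.cast_nonneg d) (add_nonneg hα hβ)) hC
  have hC₂ : 0 ≤ C2model d L a α β := by
    unfold C2model; positivity
  have h := towerLimitRate_word_king L M a ha hL hκ hC₂ (fun i => perturbationLaws_firstOrder L M a ha hd (hV i)) w
  have e : (fun k => List.foldr (fun i N => (calDalev L M a ha k)⁻¹ * Pmodel L M (V i) k * N) (calDalev L M a ha k)⁻¹ w)
      = fun k => List.foldr (fun i N => calGlev L M a ha k * Pmodel L M (V i) k * N) (calGlev L M a ha k) w := by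
    funext k
    rw [calDalev_inv]
  rw [e] at h
  exact h

end King

end Summit.QuantumFields.BalabanUV.Beta.GAN24.InsertionChainLawWords

end
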